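import Summits.ValiantsHypothesis.ValiantsHypothesis.Theorems.DivisionGapPerDivisionHardStubGenericCut
import Summits.ValiantsHypothesis.ValiantsHypothesis.Theorems.DivisionGapPerDivisionHardStubBlockFits

/-!
# Crux `DivisionGap.PerDivisionHard` (stmt-ValiantsHypothesis-5065), line `pair-descent-jss-endpoint` —
stub `stub_farRigid` (skeleton v15.1): K2 for cofactors whose support is a good CODE

If any two distinct monomials of a nonzero torus-homogeneous `h ∈ ℝ≥0[x_ij]` differ in more than
`n + 2b²` cells, `b = (log₂ n + d)^d`, then at ANY placement `eR eC` of the block arsenal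
`G(b,1) ⊕ M₀` the generic cut has a one-monomial top fibre, hence a single `G`-part.

Proof.  The placed face has at most `b² + 2b² + (n - b - b²) ≤ n + 2b²` cells
(`card_placedBlock_le`: in label coordinates a core row `i` is adjacent only to the `b` first
internal columns `(i, j, 0)` — `adj_coreRow` —, an internal row `(i, j, t)` only to the columns
`(i, j, t)` and `nextCol i j t` — `adj_internalRow` —, a padding row only to its own padding
column — `adj_paddingRow`; the explicit superset is `exists_labelEdges`).  The generic cut
(`stub_genericCut`) cuts out the placed face and two monomials of its top fibre agree OFF the
face, so they differ in at most `n + 2b²` cells; being monomials of `h`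
(`support_topComponent_subset`) they are equal by the code hypothesis.  The block fits as soon as
`b + b² ≤ n` (`stub_blockFits`).
-/

noncomputable section

-- `Summit.ValiantsHypothesis.ValiantsHypothesis.…` is the tree's mandated single-conjunct layout
-- (Sub = Summit), so the duplicated namespace component is intended.
set_option linter.dupNamespace false

namespace Summit.ValiantsHypothesis.ValiantsHypothesis.Theorems.DivisionGapPerDivisionHard

open MvPolynomial Literature.Computability.AlgebraicComplexity
open Summit.ValiantsHypothesis.ValiantsHypothesis.Theorems.ZeroOneTransfer.Negative
  (topComponent support_topComponent_subset topComponent_ne_zero)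
open scoped NNReal

variable {b k m : ℕ}

/-- **The block arsenal has few edges.**  An explicit small superset of the edge set of
`G(b,k) ⊕ M₀` (`k ≥ 1`) in label coordinates (row label, column label), of size at most
`b² + 2 b² k + m`: core row `i` — first internal column `(i, j, 0)` (`adj_coreRow`); internal row
`(i, j, t)` — column `(i, j, t)` or column `nextCol i j t` (`adj_internalRow`); padding row `u` —
padding column `u` (`adj_paddingRow`). [folklore] -/
theorem exists_labelEdges (b k m : ℕ) (hk : 0 < k) :
    ∃ T : Finset (BlockV b k m × BlockV b k m),
      (∀ r ℓ, blockAdj b k m r ℓ = true → (r, ℓ) ∈ T) ∧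
        T.card ≤ b * b + (b * (b * k) + b * (b * k)) + m := by
  classical
  refine ⟨(Finset.univ.image fun p : Fin b × Fin b =>
      ((Sum.inl p.1, iv p.1 p.2 ⟨0, hk⟩) : BlockV b k m × BlockV b k m)) ∪
    (Finset.univ.image fun p : Fin b × Fin b × Fin k =>
      ((iv p.1 p.2.1 p.2.2, iv p.1 p.2.1 p.2.2) : BlockV b k m × BlockV b k m)) ∪
    (Finset.univ.image fun p : Fin b × Fin b × Fin k =>
      ((iv p.1 p.2.1 p.2.2, nextCol p.1 p.2.1 p.2.2) : BlockV b k m × BlockV b k m)) ∪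
    (Finset.univ.image fun u : Fin m =>
      ((Sum.inr (Sum.inr u), Sum.inr (Sum.inr u)) : BlockV b k m × BlockV b k m)),
    fun r ℓ h => ?_, ?_⟩
  · -- every edge lies in the superset: case on the row label
    rcases r with i | ⟨i, j, t⟩ | u
    · obtain ⟨j, rfl⟩ := adj_coreRow hk h
      exact Finset.mem_union_left _ (Finset.mem_union_left _ (Finset.mem_union_left _
        (Finset.mem_image_of_mem _ (Finset.mem_univ (i, j)))))
    · rcases adj_internalRow h with rfl | rfl
      · exact Finset.mem_union_left _ (Finset.mem_union_left _ (Finset.mem_union_right _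
          (Finset.mem_image_of_mem _ (Finset.mem_univ (i, j, t)))))
      · exact Finset.mem_union_left _ (Finset.mem_union_right _
          (Finset.mem_image_of_mem _ (Finset.mem_univ (i, j, t))))
    · rw [adj_paddingRow h]
      exact Finset.mem_union_right _ (Finset.mem_image_of_mem _ (Finset.mem_univ u))
  · -- the superset is small: four images of small index sets
    have h₁ : (Finset.univ.image fun p : Fin b × Fin b =>
        ((Sum.inl p.1, iv p.1 p.2 ⟨0, hk⟩) : BlockV b k m × BlockV b k m)).card ≤ b * b :=
      Finset.card_image_le.trans (by simp)
    have h₂ : (Finset.univ.image fun p : Fin b × Fin b × Fin k =>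
        ((iv p.1 p.2.1 p.2.2, iv p.1 p.2.1 p.2.2) : BlockV b k m × BlockV b k m)).card ≤
        b * (b * k) :=
      Finset.card_image_le.trans (by simp)
    have h₃ : (Finset.univ.image fun p : Fin b × Fin b × Fin k =>
        ((iv p.1 p.2.1 p.2.2, nextCol p.1 p.2.1 p.2.2) : BlockV b k m × BlockV b k m)).card ≤
        b * (b * k) :=
      Finset.card_image_le.trans (by simp)
    have h₄ : (Finset.univ.image fun u : Fin m =>
        ((Sum.inr (Sum.inr u), Sum.inr (Sum.inr u)) : BlockV b k m × BlockV b k m)).card ≤ m :=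
      Finset.card_image_le.trans (by simp)
    refine (Finset.card_union_le _ _).trans ?_
    refine (Nat.add_le_add_right (Finset.card_union_le _ _) _).trans ?_
    refine (Nat.add_le_add_right (Nat.add_le_add_right (Finset.card_union_le _ _) _) _).trans ?_
    omega

/-- **The placed face is small.**  For `k ≥ 1` and any placement `eR eC : BlockV b k m ≃ Fin n`,
the placed block graph `placedBlock eR eC` has at most `b² + 2 b² k + m` cells: it is contained
in the image under `(eR, eC)` of the small label superset `exists_labelEdges`. [folklore] -/
theorem card_placedBlock_le {n : ℕ} (hk : 0 < k) (eR eC : BlockV b k m ≃ Fin n) :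
    (placedBlock eR eC).card ≤ b * b + (b * (b * k) + b * (b * k)) + m := by
  classical
  obtain ⟨T, hT, hTcard⟩ := exists_labelEdges b k m hk
  have hsub : placedBlock eR eC ⊆ T.image fun p => (eR p.1, eC p.2) := by
    intro e he
    simp only [placedBlock, Finset.mem_filter, Finset.mem_univ, true_and] at he
    exact Finset.mem_image.mpr ⟨(eR.symm e.1, eC.symm e.2), hT _ _ he, by simp⟩
  exact (Finset.card_le_card hsub).trans (Finset.card_image_le.trans hTcard)

/-- **`stub_farRigid` (K2 of line `pair-descent-jss-endpoint` for cofactors whose support is a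
good CODE; skeleton v15.1).**  For every `d` there is `n₀` such that for `n ≥ n₀`: if any two
distinct monomials of a nonzero torus-homogeneous `h` differ in more than `n + 2b²` cells,
`b = (log₂ n + d)^d`, then for a placement `eR eC` of `G(b,1) ⊕ M₀` (any fits, `stub_blockFits`),
the generic cut `w` (`stub_genericCut`) and some `u` satisfy `CutsOut w (placedBlock eR eC)` and
`HasSingleGPart (placedBlock eR eC) w h u`: two monomials of the top fibre agree off the face,
which has at most `n + 2b²` cells (`card_placedBlock_le`), so they coincide. [folklore] -/
theorem stub_farRigid :
    ∀ d : ℕ, ∃ n₀ : ℕ, ∀ n ≥ n₀, ∀ h : MvPolynomial (Fin n × Fin n) ℝ≥0,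
      h ≠ 0 → IsTorusHomogeneous h →
      (∀ m₁ ∈ h.support, ∀ m₂ ∈ h.support, m₁ ≠ m₂ →
        n + 2 * ((Nat.log 2 n + d) ^ d * (Nat.log 2 n + d) ^ d) <
          (Finset.univ.filter fun e : Fin n × Fin n => m₁ e ≠ m₂ e).card) →
      ∃ (b k m : ℕ) (eR eC : BlockV b k m ≃ Fin n) (w : Fin n × Fin n → ℕ)
        (u : (Fin n × Fin n) →₀ ℕ),
        (Nat.log 2 n + d) ^ d ≤ b ∧ CutsOut w (placedBlock eR eC) ∧
          HasSingleGPart (placedBlock eR eC) w h u := by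
  intro d
  obtain ⟨n₀, hfit⟩ := stub_blockFits d
  refine ⟨n₀ + 1, fun n hn h hh htor hfar => ?_⟩
  classical
  set b := (Nat.log 2 n + d) ^ d with hb
  have hbn : b + b * (b * 1) ≤ n := hfit n (by omega) 1 (by omega)
  -- any placement: the core and internal labels on any `b + b²` rows (and columns)
  obtain ⟨R, -, hRcard⟩ := Finset.exists_subset_card_eq
    (show b + b * (b * 1) ≤ (Finset.univ : Finset (Fin n)).card by simpa using hbn)
  obtain ⟨eR, -, -⟩ := exists_blockEquiv R b 1 (n - (b + b * (b * 1))) hRcard (by rw [hRcard])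
  obtain ⟨eC, -, -⟩ := exists_blockEquiv R b 1 (n - (b + b * (b * 1))) hRcard (by rw [hRcard])
  set G := placedBlock eR eC with hG
  -- the generic cut: all monomials of `h` have the same degree
  have hdeg : ∀ p₁ ∈ h.support, ∀ p₂ ∈ h.support, p₁.degree = p₂.degree := by
    intro p₁ hp₁ p₂ hp₂
    obtain ⟨r₀, c₀, hrc⟩ := htor
    exact degree_eq_of_rowDegrees_eq ((hrc p₁ hp₁).1.trans (hrc p₂ hp₂).1.symm)
  obtain ⟨w, hcut, hagree⟩ :=
    stub_genericCut b 1 (n - (b + b * (b * 1))) n eR eC h Nat.one_pos hdeg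
  -- the face is small
  have hGcard : G.card ≤ n + 2 * (b * b) := by
    rw [hG]
    have h1 := card_placedBlock_le Nat.one_pos eR eC
    simp only [Nat.mul_one] at h1 hbn
    omega
  -- its top fibre is a single monomial: two fibre monomials differ only inside the face
  have hfib : ∀ m₁ ∈ (topComponent w h).support, ∀ m₂ ∈ (topComponent w h).support,
      m₁ = m₂ := by
    intro m₁ hm₁ m₂ hm₂
    by_contra hne
    have hs₁ := support_topComponent_subset _ h hm₁
    have hs₂ := support_topComponent_subset _ h hm₂
    have hsub : (Finset.univ.filter fun e : Fin n × Fin n => m₁ e ≠ m₂ e) ⊆ G := by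
      intro e he
      by_contra heG
      exact (Finset.mem_filter.mp he).2 (hagree m₁ hm₁ m₂ hm₂ e heG)
    have := hfar m₁ hs₁ m₂ hs₂ hne
    have := Finset.card_le_card hsub
    omega
  -- conclusion: `u` is the `G`-part of the unique monomial of the top fibre
  obtain ⟨m₀, hm₀⟩ := support_nonempty.mpr (topComponent_ne_zero w hh)
  refine ⟨b, 1, n - (b + b * (b * 1)), eR, eC, w, m₀.filter (· ∈ G), le_rfl, hcut,
    fun e he => ?_, fun m' hm' e he => ?_⟩
  · rw [Finsupp.support_filter] at he
    exact (Finset.mem_filter.mp he).2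
  · rw [hfib m' hm' m₀ hm₀, Finsupp.filter_apply_pos _ _ he]

end Summit.ValiantsHypothesis.ValiantsHypothesis.Theorems.DivisionGapPerDivisionHard

end
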